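import Literature.AlgebraicGeometry.HodgeTheory.WeilClassesFieldSubringDecomposable
import HarnessLib

/-!
# Moonen–Zarhin's Criterion (2), the type-2 rows on `A` FROM `End(A)`: the rational representation `φ ↦ φ^*` on `H¹` is
# a ring antihomomorphism (public API: `≫`, `𝟙`, `0`, `+`, `-`, `n •`, integer polynomials), so squares, anticommutation,
# commutation and subring membership transfer from `End(A)` to `H¹`; the quaternion rows with End-level hypotheses
# (Lange–Birkenhake §1.1; Moonen–Zarhin 1998 §1)

Layer `Literature/AlgebraicGeometry/HodgeTheory`; THEOREMS ONLY — no definition, no named fact, no `sorry` (D-0026, net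
debt 0).  §1 makes public the pull-back calculus that the lane's files keep re-proving privately; §2 restates the
seat's `m = 1` quaternion rows with every ALGEBRA hypothesis in `End(A)` (only the Rosati symmetry of the generators
and the class `h` stay on the carrier).

## The print

H. Lange, Ch. Birkenhake, *Complex Abelian Varieties* (1992) [LangeBirkenhake1992], §1.1: the analytic and rational
representations `ρ_a : End(X) → End(T₀X)`, `ρ_r : End(X) → End_ℤ(H₁(X, ℤ))` are (injective) ring homomorphisms; on
cohomology `H¹ = H₁^∨` the induced `φ ↦ φ^*` reverses products.  B. J. J. Moonen, Yu. G. Zarhin, *Weil classes on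
abelian varieties* [MoonenZarhin1998WeilClasses], §1 Criterion (2), type 2, `m = 1` (chunk p0003 L46–L90).

## What is proved (on `H¹(A(ℂ); ℂ)`)

§1 `pullbackOne_comp_eq_mul` (`(f ≫ g)^* = f^* g^*`), `pullbackOne_id_eq_one`, `pullbackOne_zero_eq_zero`,
`pullbackOne_add_eq_add`, `pullbackOne_neg_eq_neg`, `pullbackOne_sub_eq_sub`, `pullbackOne_zsmul`,
`pullbackOne_zsmul_id` (`[n]^* = n`), **`pullbackOne_eval₂`** (`p(ψ)^* = p̄(ψ^*)`).
§2 **`weilClassesField_le_algebraicClasses_of_quaternionPair_End`** (`α² = [a]`, `β² = [b]`, `αβ = -βα`, `φ ∈ ℤ⟨α, β⟩`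
in `End(A)`) and **`weilClassesField_le_algebraicClasses_of_quaternionOver_End`** (`Q(ψ) = 0`, `α² = a(ψ)`, `β² = b(ψ)`
units of `E₀`, `ψα = αψ`, `ψβ = βψ`, `αβ = -βα`, `φ ∈ ℤ⟨ψ, α, β⟩` in `End(A)`).

Scope (honest column).  The Rosati symmetry of `ψ, α, β` is still a hypothesis on the carrier (`Q_h(γ^* v, w) =
Q_h(v, γ^* w)`), not derived from the Rosati involution of `End⁰(A)`; integral data.

## References

* [LangeBirkenhake1992] H. Lange, Ch. Birkenhake, Complex Abelian Varieties, Grundlehren 302 (1992), §1.1, §5.1.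
* [MoonenZarhin1998WeilClasses] B. J. J. Moonen, Yu. G. Zarhin, Weil classes on abelian varieties, J. reine angew.
  Math. 496 (1998) 83–92; arXiv:alg-geom/9612017: §1 Tables 1–2 (chunk p0002 L60–L118), Criterion (2) and its proof
  (chunk p0003 L46–L90).
* [VoisinHodgeI2002] C. Voisin, Hodge Theory and Complex Algebraic Geometry I (CUP 2002), Thm. 11.30.

## Provenance

Lane `lit-hodgefound` (Track 2, Layer A), prover seat `lit-hodgefound-p21` (generation 21), row g21-#12.
-/

noncomputable section

open CategoryTheory CategoryTheory.Limits
open Literature.AlgebraicTopology.SingularHomology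
open Literature.AlgebraicGeometry.Motives
open Literature.AlgebraicGeometry.VanGeemen1994 (hodgeClassSpan pullbackOne)
open Literature.AlgebraicGeometry.Milne1999
open Literature.Geometry.Kaehler (lefschetzPow)
open Literature.Barriers.HodgeConjecture (divisorClassesSpan)
open Literature.LinearAlgebra
open Polynomial

namespace Literature.AlgebraicGeometry.HodgeTheory

/-! ### §1 `φ ↦ φ^*` on `H¹(A(ℂ); ℂ)` is a ring antihomomorphism `End(A) → End_ℂ(H¹)` (public API) -/

section PullbackRing

variable {A : AbelianVariety ℂ}

/-- **`(f ≫ g)^* = f^* ∘ g^*`** on `H¹(A(ℂ); ℂ)`: pull-back reverses composition (in `Module.End`, `f^* * g^*`). The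
rational representation `End(A) → End(H¹)` is a ring antihomomorphism. [cite: LangeBirkenhake1992, §1.1 (the analytic and rational representations)] -/
theorem pullbackOne_comp_eq_mul (f g : A ⟶ A) : pullbackOne A (f ≫ g) = pullbackOne A f * pullbackOne A g := by
  change (complexBetti.map (f.hom.hom.hom ≫ g.hom.hom.hom) 1).hom = _
  rw [complexBetti.map_comp, ModuleCat.hom_comp]
  rfl

/-- `𝟙^* = 1`. [cite: LangeBirkenhake1992, §1.1] -/
theorem pullbackOne_id_eq_one : pullbackOne A (𝟙 A) = 1 := by
  refine LinearMap.ext fun v ↦ ?_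
  change singularCohomology.map ℂ ℂ (Motives.AlgPoints.mapContinuous (L := ℂ) (𝟙 A : A ⟶ A).hom.hom.hom) 1 v = v
  exact abelianVariety_map_id_apply v

/-- `0^* = 0` on `H¹`. [cite: LangeBirkenhake1992, §1.1] -/
theorem pullbackOne_zero_eq_zero : pullbackOne A (0 : A ⟶ A) = 0 := by
  change (complexBetti.map (0 : A ⟶ A).hom.hom.hom 1).hom = 0
  rw [complexBetti_map_zero_one, ModuleCat.hom_zero]

/-- `(f + g)^* = f^* + g^*` on `H¹`. [cite: LangeBirkenhake1992, §1.1] -/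
theorem pullbackOne_add_eq_add (f g : A ⟶ A) : pullbackOne A (f + g) = pullbackOne A f + pullbackOne A g := by
  change (complexBetti.map (f + g).hom.hom.hom 1).hom = _
  rw [complexBetti_map_add_one, ModuleCat.hom_add]

/-- `(-f)^* = -f^*` on `H¹`. [cite: LangeBirkenhake1992, §1.1] -/
theorem pullbackOne_neg_eq_neg (f : A ⟶ A) : pullbackOne A (-f) = -pullbackOne A f := by
  change (complexBetti.map (-f).hom.hom.hom 1).hom = _
  rw [complexBetti_map_neg_one, ModuleCat.hom_neg]

/-- `(f - g)^* = f^* - g^*` on `H¹`. [cite: LangeBirkenhake1992, §1.1] -/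
theorem pullbackOne_sub_eq_sub (f g : A ⟶ A) : pullbackOne A (f - g) = pullbackOne A f - pullbackOne A g := by
  rw [sub_eq_add_neg, pullbackOne_add_eq_add, pullbackOne_neg_eq_neg, sub_eq_add_neg]

/-- `(n • f)^* = n f^*` on `H¹`, `n : ℤ`. [cite: LangeBirkenhake1992, §1.1] -/
theorem pullbackOne_zsmul (n : ℤ) (f : A ⟶ A) : pullbackOne A (n • f) = (n : ℂ) • pullbackOne A f := by
  change (complexBetti.map (n • f).hom.hom.hom 1).hom = _
  rw [complexBetti_map_zsmul_one, ModuleCat.hom_zsmul, Int.cast_smul_eq_zsmul]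

/-- `[n]^* = n` on `H¹` (`(n • 𝟙)^* = n · 1`). [cite: LangeBirkenhake1992, §1.1] -/
theorem pullbackOne_zsmul_id (n : ℤ) : pullbackOne A (n • 𝟙 A) = (n : ℂ) • (1 : Module.End ℂ (complexBetti A.X 1)) := by
  rw [pullbackOne_zsmul, pullbackOne_id_eq_one]

/-- **`p(ψ)^* = p̄(ψ^*)`**: the pull-back of an integer polynomial in `ψ ∈ End(A)` is the same polynomial (coefficients in
`ℂ`) of `ψ^*` — the tree's `hom_complexBetti_map_eval₂_one` in `pullbackOne` form. [cite: LangeBirkenhake1992, §1.1] -/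
theorem pullbackOne_eval₂ (ψ : A ⟶ A) (p : Polynomial ℤ) :
    pullbackOne A (Polynomial.eval₂ (Int.castRingHom (CategoryTheory.End A)) (ψ : CategoryTheory.End A) p :) =
      aeval (pullbackOne A ψ) (p.map (Int.castRingHom ℂ)) :=
  hom_complexBetti_map_eval₂_one ψ p

end PullbackRing

/-! ### §2 The quaternion rows on `A` from End-LEVEL data -/

section EndLevel

variable {A : AbelianVariety ℂ} {h : complexBetti A.X 2} {ψ α β φ : A ⟶ A} {P Q qa qb : Polynomial ℤ} {e m : ℕ} {a b : ℤ}

/-- **TYPE 2, `m = 1`, CENTRE `ℚ`, FROM `End(A)`: the Weil classes of `F = ℚ(φ)`, `φ ∈ ℤ⟨α, β⟩`, are ALGEBRAIC** for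
`α, β ∈ End(A)` with `α² = [a]`, `β² = [b]` (`a, b ∈ ℤ ∖ {0}`), `αβ = -βα`, both Rosati-symmetric on `H¹` (`Q_h(α^* v, w) =
Q_h(v, α^* w)`), `h ∈ B¹ ⊗ ℂ` with `Q_h` non-degenerate, `P(φ) = 0` (`P` monic irreducible, `deg P · 2m = 2 dim A`):
`weilClassesField_le_algebraicClasses_of_quaternionPair` (`WeilClassesFieldDecomposableOfMatrixUnits`) with all
algebra hypotheses stated in `End(A)` and transported by §1. [cite: MoonenZarhin1998WeilClasses, Introduction (chunk p0001 L10–L18) and §1 Criterion (2), type 2 with m = 1 (chunk p0003 L46–L90)]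
[cite: VoisinHodgeI2002, Thm. 11.30] -/
theorem weilClassesField_le_algebraicClasses_of_quaternionPair_End
    (hPm : P.Monic) (hPe : P.natDegree = e) (hPirr : Irreducible (P.map (Int.castRingHom ℚ)))
    (hφ : Polynomial.eval₂ (Int.castRingHom (CategoryTheory.End A)) (φ : CategoryTheory.End A) P = 0)
    (her : e * (2 * m) = 2 * A.dim) (hh : h ∈ hodgeClassSpan A.dim A.X 1)
    (hnd : ∀ v : complexBetti A.X 1, (∀ w, polarizationPairingOne A.X h (A.dim - 1) v w = 0) → v = 0)
    (ha : a ≠ 0) (hα2 : α ≫ α = a • 𝟙 A) (hb : b ≠ 0) (hβ2 : β ≫ β = b • 𝟙 A) (hanti : α ≫ β = -(β ≫ α))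
    (hαsym : ∀ v w : complexBetti A.X 1, polarizationPairingOne A.X h (A.dim - 1) (pullbackOne A α v) w =
      polarizationPairingOne A.X h (A.dim - 1) v (pullbackOne A α w))
    (hβsym : ∀ v w : complexBetti A.X 1, polarizationPairingOne A.X h (A.dim - 1) (pullbackOne A β v) w =
      polarizationPairingOne A.X h (A.dim - 1) v (pullbackOne A β w))
    (hφe : End.of φ ∈ Subring.closure {End.of α, End.of β}) :
    weilClassesField A φ P (2 * m) ≤ algebraicClasses A.X m := by
  have hα2' : pullbackOne A α * pullbackOne A α = (a : ℂ) • 1 := by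
    rw [← pullbackOne_comp_eq_mul, hα2, pullbackOne_zsmul_id]
  have hβ2' : pullbackOne A β * pullbackOne A β = (b : ℂ) • 1 := by
    rw [← pullbackOne_comp_eq_mul, hβ2, pullbackOne_zsmul_id]
  have hanti' : pullbackOne A α * pullbackOne A β = -(pullbackOne A β * pullbackOne A α) := by
    rw [← pullbackOne_comp_eq_mul, hanti, pullbackOne_neg_eq_neg, pullbackOne_comp_eq_mul]
  exact weilClassesField_le_algebraicClasses_of_mem_closure_quaternionPair hPm hPe hPirr hφ her hh hnd
    (Int.cast_ne_zero.2 ha) hα2' (Int.cast_ne_zero.2 hb) hβ2' hanti' hαsym hβsym hφe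

/-- **TYPE 2, `m = 1`, REAL-MULTIPLICATION CENTRE, FROM `End(A)`: the Weil classes of `F = ℚ(φ)`, `φ ∈ ℤ⟨ψ, α, β⟩`, are
ALGEBRAIC** for `ψ ∈ End(A)` Rosati-symmetric with `Q(ψ) = 0` (`Q` monic irreducible over `ℚ`), `α, β ∈ End(A)`
Rosati-symmetric, commuting with `ψ`, anticommuting, `α² = a(ψ)`, `β² = b(ψ)` with `a, b ∈ ℤ[X]` not vanishing at any
complex root of `Q` (`α², β² ∈ E₀^×`): `weilClassesField_le_algebraicClasses_of_mem_adjoin_quaternionOver`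
(`WeilClassesFieldQuaternionOverRealFieldDecomposable`) with all algebra hypotheses stated in `End(A)`.
[cite: MoonenZarhin1998WeilClasses, Introduction (chunk p0001 L10–L18) and §1 Criterion (2), type 2 with m = 1 (chunk p0003 L46–L90); Tables 1–2 (chunk p0002 L60–L118)]
[cite: VoisinHodgeI2002, Thm. 11.30] -/
theorem weilClassesField_le_algebraicClasses_of_quaternionOver_End
    (hPm : P.Monic) (hPe : P.natDegree = e) (hPirr : Irreducible (P.map (Int.castRingHom ℚ)))
    (hφ : Polynomial.eval₂ (Int.castRingHom (CategoryTheory.End A)) (φ : CategoryTheory.End A) P = 0)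
    (her : e * (2 * m) = 2 * A.dim) (hh : h ∈ hodgeClassSpan A.dim A.X 1)
    (hnd : ∀ v : complexBetti A.X 1, (∀ w, polarizationPairingOne A.X h (A.dim - 1) v w = 0) → v = 0)
    (hψsym : ∀ v w : complexBetti A.X 1, polarizationPairingOne A.X h (A.dim - 1) (pullbackOne A ψ v) w =
      polarizationPairingOne A.X h (A.dim - 1) v (pullbackOne A ψ w))
    (hQm : Q.Monic) (hQirr : Irreducible (Q.map (Int.castRingHom ℚ)))
    (hψQ : Polynomial.eval₂ (Int.castRingHom (CategoryTheory.End A)) (ψ : CategoryTheory.End A) Q = 0)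
    (hα2 : α ≫ α = Polynomial.eval₂ (Int.castRingHom (CategoryTheory.End A)) (ψ : CategoryTheory.End A) qa)
    (hqa : ∀ z : ℂ, (Q.map (Int.castRingHom ℂ)).IsRoot z → (qa.map (Int.castRingHom ℂ)).eval z ≠ 0)
    (hβ2 : β ≫ β = Polynomial.eval₂ (Int.castRingHom (CategoryTheory.End A)) (ψ : CategoryTheory.End A) qb)
    (hqb : ∀ z : ℂ, (Q.map (Int.castRingHom ℂ)).IsRoot z → (qb.map (Int.castRingHom ℂ)).eval z ≠ 0)
    (hanti : α ≫ β = -(β ≫ α))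
    (hαsym : ∀ v w : complexBetti A.X 1, polarizationPairingOne A.X h (A.dim - 1) (pullbackOne A α v) w =
      polarizationPairingOne A.X h (A.dim - 1) v (pullbackOne A α w))
    (hβsym : ∀ v w : complexBetti A.X 1, polarizationPairingOne A.X h (A.dim - 1) (pullbackOne A β v) w =
      polarizationPairingOne A.X h (A.dim - 1) v (pullbackOne A β w))
    (hψα : ψ ≫ α = α ≫ ψ) (hψβ : ψ ≫ β = β ≫ ψ)
    (hφe : End.of φ ∈ Subring.closure {End.of ψ, End.of α, End.of β}) :
    weilClassesField A φ P (2 * m) ≤ algebraicClasses A.X m := by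
  have hα2' : pullbackOne A α * pullbackOne A α = aeval (pullbackOne A ψ) (qa.map (Int.castRingHom ℂ)) := by
    rw [← pullbackOne_comp_eq_mul, hα2]
    exact pullbackOne_eval₂ ψ qa
  have hβ2' : pullbackOne A β * pullbackOne A β = aeval (pullbackOne A ψ) (qb.map (Int.castRingHom ℂ)) := by
    rw [← pullbackOne_comp_eq_mul, hβ2]
    exact pullbackOne_eval₂ ψ qb
  have hanti' : pullbackOne A α * pullbackOne A β = -(pullbackOne A β * pullbackOne A α) := by
    rw [← pullbackOne_comp_eq_mul, hanti, pullbackOne_neg_eq_neg, pullbackOne_comp_eq_mul]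
  have hψα' : pullbackOne A ψ * pullbackOne A α = pullbackOne A α * pullbackOne A ψ := by
    rw [← pullbackOne_comp_eq_mul, hψα, pullbackOne_comp_eq_mul]
  have hψβ' : pullbackOne A ψ * pullbackOne A β = pullbackOne A β * pullbackOne A ψ := by
    rw [← pullbackOne_comp_eq_mul, hψβ, pullbackOne_comp_eq_mul]
  exact weilClassesField_le_algebraicClasses_of_mem_closure_quaternionOver hPm hPe hPirr hφ her hh hnd hψsym hQm hQirr
    hψQ hα2' hqa hβ2' hqb hanti' hαsym hβsym hψα' hψβ' hφe

end EndLevel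

end Literature.AlgebraicGeometry.HodgeTheory

end
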